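import Mathlib

/-!
# The `L^p` Kolmogorov-entropy currency for the Katz–Pavlović chain versus the sub-Onsager shell barrier
# (helper file for the crux `SubOnsagerCeiling.ForwardTailCeilingKP`, stmt-NavierStokesRegularity-27057, `--supports`)

The registered stubs `stub_primaryGradedLargeRatio` / `stub_primaryGradedSmallRatio` of the LEAD skeleton
`Cruxes/ForwardTailCeilingKP/Lines/kp_shell_barrier.lean` contain the ν-uniform θ-shell barrier `b^{2θn}·E_n(t) ≤ D·E₀`,
`θ > 1/2`, for the positive Katz–Pavlović chain at EVERY scale ratio `b = 1+ε₀ ∈ (1, 2]` (`Λ = b^{5/2}`, shell energies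
`E_n = ½x_n²`).  In the continuum limit `b ↓ 1` the chain is the scalar conservation law `W_t + (W^{3/2})_ξ = 0` for the
Kolmogorov-normalised energy `W = Λ^{2n/3}E_n` on the finite interval `dξ = Λ^{-2n/3}dn`, whose Kružkov entropies
`∫ W^p dξ` are non-increasing [cite: Kruzkov1970, §3 Thm. 1].  Their lattice analogues are the KOLMOGOROV ENTROPIES

  `S_p(t) = Σ_n Λ^{(2/3)(p-1)n} E_n(t)^p = Σ_n b^{(5/3)(p-1)n} E_n(t)^p`   (`S_1` = energy).

This file records, as pure real analysis on an abstract non-negative shell sequence `E : ℕ → ℝ` (one time slice), the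
exact exchange rate between an `S_p`-ceiling and the shell barrier — the currency in which hand leafhand-4-g6's entropy
census (evidence memo ENTROPY-CENSUS-leafhand4-g6.md on the item: along one-shell-datum trajectories `sup_t S_3(t) = S_3(0)`
at every tested `b ∈ [1.05, 2]`, inviscid to front arrival and viscous through the wake) is stated:

* `kpEntropy_exponent` — the exponent dictionary `θ_p = (5/6)(1 − 1/p)`: `θ_p > 1/2 ↔ p > 5/2` (for `p > 0`), `θ_3 = 5/9`;
* `kpEntropy_shell_le` — ONE TERM OF AN `S_p`-CEILING IS A SHELL BARRIER: if `b^{(5/3)(p-1)n}·E_n^p ≤ M` (`p ≥ 1`, e.g. every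
  term of a sum `≤ M`), then `b^{2θ_p n}·E_n ≤ M^{1/p}`;
* `kpEntropy_term_le_of_barrier` — conversely a `θ`-barrier `b^{2θn}E_n ≤ D` bounds the `n`-th entropy term by the geometric
  quantity `D^p·(b^{(5/3)(p-1) - 2θp})^n`, whose ratio is `< 1` exactly when `θ > θ_p` (`kpEntropy_ratio_lt_one`), so that the
  partial sums of `S_p` are bounded by `D^p/(1 - r)` (`kpEntropy_partialSum_le_of_barrier`).

So «`sup_t S_p(t) ≤ C·E₀^p` for some `p > 5/2`» and «θ-shell barrier for some `θ > 1/2`» are the same statement up to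
constants; the entropy form is a SUM functional (second-order entropy production `−¼Σ(η_n−η_{n+1})²` at the Kolmogorov state,
memo §3), the barrier form a SUP functional.  HONEST FRAMING: bookkeeping about a MODEL lattice ODE (route SubOnsagerCeiling,
rung TL-M2Break); no stub, crux or summit is proved here and nothing in this file bears on Navier–Stokes regularity.
-/

noncomputable section

-- the sub-problem namespace `NavierStokesRegularity.NavierStokesRegularity` is the tree's layout (D-0017)
set_option linter.dupNamespace false

namespace Summit.NavierStokesRegularity.NavierStokesRegularity.Theorems

/-- **The entropy-exponent dictionary.** With `θ_p = (5/6)(1 − 1/p)` (the shell-barrier exponent carried by one term of the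
`p`-th Kolmogorov entropy): for `p > 0`, `θ_p > 1/2 ↔ p > 5/2`; and `θ_3 = 5/9`, `θ_p < 5/6` (the Kolmogorov value is the
limit `p → ∞`). [folklore] -/
theorem kpEntropy_exponent {p : ℝ} (hp : 0 < p) :
    ((1 : ℝ) / 2 < 5 / 6 * (1 - 1 / p) ↔ 5 / 2 < p) ∧ (5 : ℝ) / 6 * (1 - 1 / (3 : ℝ)) = 5 / 9 ∧
      (5 : ℝ) / 6 * (1 - 1 / p) < 5 / 6 := by
  refine ⟨⟨fun h => ?_, fun h => ?_⟩, by norm_num, ?_⟩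
  · -- from `1/2 < 5/6 (1 - 1/p)` get `1/p < 2/5`, hence `p > 5/2`
    have h1 : 1 / p < 2 / 5 := by linarith
    rw [div_lt_div_iff₀ hp (by norm_num)] at h1
    linarith
  · have h1 : 1 / p < 2 / 5 := by
      rw [div_lt_div_iff₀ hp (by norm_num)]; linarith
    linarith
  · have h1 : 0 < 1 / p := by positivity
    linarith

/-- **One term of an `S_p`-ceiling is a shell barrier.** For `b > 0`, `p ≥ 1` and a shell energy `E ≥ 0` at shell `n`:
if `b^{(5/3)(p-1)n} · E^p ≤ M` then `b^{2θ_p n} · E ≤ M^{1/p}` with `2θ_p = (5/3)(1 − 1/p)` (take `p`-th roots; the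
weight `b^{(5/3)(p-1)n}` is `Λ^{(2/3)(p-1)n}`, `Λ = b^{5/2}`). [folklore] -/
theorem kpEntropy_shell_le {b p E M : ℝ} (hb : 0 < b) (hp : 1 ≤ p) (hE : 0 ≤ E) {n : ℕ}
    (h : b ^ ((5 : ℝ) / 3 * (p - 1) * n) * E ^ p ≤ M) :
    b ^ ((5 : ℝ) / 3 * (1 - 1 / p) * n) * E ≤ M ^ (1 / p) := by
  have hp0 : 0 < p := by linarith
  have hbw : 0 < b ^ ((5 : ℝ) / 3 * (p - 1) * n) := Real.rpow_pos_of_pos hb _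
  have hM : 0 ≤ M := le_trans (mul_nonneg hbw.le (Real.rpow_nonneg hE p)) h
  -- the left-hand side is the `p`-th root of `b^{(5/3)(p-1)n} E^p`
  have key : (b ^ ((5 : ℝ) / 3 * (p - 1) * n) * E ^ p) ^ (1 / p) =
      b ^ ((5 : ℝ) / 3 * (1 - 1 / p) * n) * E := by
    rw [Real.mul_rpow hbw.le (Real.rpow_nonneg hE p), ← Real.rpow_mul hb.le, ← Real.rpow_mul hE]
    have h1 : (5 : ℝ) / 3 * (p - 1) * n * (1 / p) = 5 / 3 * (1 - 1 / p) * n := by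
      field_simp
    have h2 : p * (1 / p) = 1 := by field_simp
    rw [h1, h2, Real.rpow_one]
  rw [← key]
  exact Real.rpow_le_rpow (mul_nonneg hbw.le (Real.rpow_nonneg hE p)) h (by positivity)

/-- **A θ-barrier bounds each entropy term geometrically.** For `b > 0`, `p ≥ 1`, `E ≥ 0` at shell `n`: if
`b^{2θn} · E ≤ D` then `b^{(5/3)(p-1)n} · E^p ≤ D^p · (b^{(5/3)(p-1) - 2θp})^n`. [folklore] -/
theorem kpEntropy_term_le_of_barrier {b p θ E D : ℝ} (hb : 0 < b) (hp : 1 ≤ p) (hE : 0 ≤ E) {n : ℕ}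
    (h : b ^ (2 * θ * n) * E ≤ D) :
    b ^ ((5 : ℝ) / 3 * (p - 1) * n) * E ^ p ≤ D ^ p * (b ^ ((5 : ℝ) / 3 * (p - 1) - 2 * θ * p)) ^ n := by
  have hp0 : 0 ≤ p := by linarith
  have hbθ : 0 < b ^ (2 * θ * n) := Real.rpow_pos_of_pos hb _
  have hD : 0 ≤ D := le_trans (mul_nonneg hbθ.le hE) h
  -- raise the barrier to the power `p`
  have hpow : (b ^ (2 * θ * n) * E) ^ p ≤ D ^ p := Real.rpow_le_rpow (mul_nonneg hbθ.le hE) h hp0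
  rw [Real.mul_rpow hbθ.le hE, ← Real.rpow_mul hb.le] at hpow
  -- bookkeeping of the weights: `b^{(5/3)(p-1)n} = b^{2θnp} · (b^{(5/3)(p-1) - 2θp})^n`
  have hsplit : b ^ ((5 : ℝ) / 3 * (p - 1) * n) =
      b ^ (2 * θ * n * p) * (b ^ ((5 : ℝ) / 3 * (p - 1) - 2 * θ * p)) ^ n := by
    rw [← Real.rpow_mul_natCast hb.le, ← Real.rpow_add hb]
    congr 1; ring
  rw [hsplit, mul_assoc, mul_comm ((b ^ ((5 : ℝ) / 3 * (p - 1) - 2 * θ * p)) ^ n), ← mul_assoc]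
  exact mul_le_mul_of_nonneg_right hpow (pow_nonneg (Real.rpow_nonneg hb.le _) n)

/-- **The geometric ratio is `< 1` exactly in the super-`θ_p` range.** For `b > 1`, `p > 0`:
`b^{(5/3)(p-1) - 2θp} < 1 ↔ (5/6)(1 − 1/p) < θ`. [folklore] -/
theorem kpEntropy_ratio_lt_one {b p θ : ℝ} (hb : 1 < b) (hp : 0 < p) :
    b ^ ((5 : ℝ) / 3 * (p - 1) - 2 * θ * p) < 1 ↔ 5 / 6 * (1 - 1 / p) < θ := by
  have h2 : (5 : ℝ) / 6 * (1 - 1 / p) = (5 / 3 * (p - 1)) / (2 * p) := by field_simp; ring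
  rw [Real.rpow_lt_one_iff_of_pos (by linarith), h2, div_lt_iff₀ (by linarith)]
  constructor
  · rintro (⟨_, hneg⟩ | ⟨hb1, _⟩)
    · have : (5 : ℝ) / 3 * (p - 1) < 2 * θ * p := by linarith
      calc (5 : ℝ) / 3 * (p - 1) < 2 * θ * p := this
        _ = θ * (2 * p) := by ring
    · linarith
  · intro h
    left
    refine ⟨hb, ?_⟩
    have : θ * (2 * p) = 2 * θ * p := by ring
    linarith

/-- **A θ-barrier with `θ > θ_p` gives an `S_p`-ceiling.** For `b > 1`, `p ≥ 1`, a non-negative shell sequence `E` with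
`b^{2θn}·E_n ≤ D` for all `n` and `(5/6)(1 − 1/p) < θ`: every partial sum of the `p`-th Kolmogorov entropy is bounded,
`Σ_{n<N} b^{(5/3)(p-1)n} E_n^p ≤ D^p / (1 − r)`, `r = b^{(5/3)(p-1) - 2θp} < 1`. [folklore] -/
theorem kpEntropy_partialSum_le_of_barrier {b p θ D : ℝ} (hb : 1 < b) (hp : 1 ≤ p) {E : ℕ → ℝ}
    (hE : ∀ n, 0 ≤ E n) (hbar : ∀ n : ℕ, b ^ (2 * θ * n) * E n ≤ D) (hθ : 5 / 6 * (1 - 1 / p) < θ) (N : ℕ) :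
    ∑ n ∈ Finset.range N, b ^ ((5 : ℝ) / 3 * (p - 1) * n) * E n ^ p ≤
      D ^ p / (1 - b ^ ((5 : ℝ) / 3 * (p - 1) - 2 * θ * p)) := by
  have hb0 : 0 < b := by linarith
  set r : ℝ := b ^ ((5 : ℝ) / 3 * (p - 1) - 2 * θ * p) with hr
  have hr0 : 0 ≤ r := Real.rpow_nonneg hb0.le _
  have hr1 : r < 1 := (kpEntropy_ratio_lt_one hb (by linarith)).2 hθ
  have hD : 0 ≤ D := by
    have := hbar 0
    have h0 : b ^ (2 * θ * ((0 : ℕ) : ℝ)) = 1 := by simp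
    rw [h0, one_mul] at this
    exact le_trans (hE 0) this
  have hDp : 0 ≤ D ^ p := Real.rpow_nonneg hD p
  have hgeom : ∑ n ∈ Finset.range N, r ^ n ≤ 1 / (1 - r) := by
    have h : ∑ i ∈ Finset.Ico 0 N, r ^ i ≤ r ^ 0 / (1 - r) := geom_sum_Ico_le_of_lt_one hr0 hr1
    rw [pow_zero, Nat.Ico_zero_eq_range] at h
    exact h
  calc ∑ n ∈ Finset.range N, b ^ ((5 : ℝ) / 3 * (p - 1) * n) * E n ^ p
      ≤ ∑ n ∈ Finset.range N, D ^ p * r ^ n :=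
        Finset.sum_le_sum fun n _ => kpEntropy_term_le_of_barrier hb0 hp (hE n) (hbar n)
    _ = D ^ p * ∑ n ∈ Finset.range N, r ^ n := by rw [Finset.mul_sum]
    _ ≤ D ^ p * (1 / (1 - r)) := mul_le_mul_of_nonneg_left hgeom hDp
    _ = D ^ p / (1 - r) := by rw [mul_one_div]

end Summit.NavierStokesRegularity.NavierStokesRegularity.Theorems

end
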